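import Summits.QuantumFields.YangMills.Theorems.UnitScaleTiltProp7HermiteLineCovariant
import Summits.QuantumFields.YangMills.Theorems.UnitScaleTiltProp7HermiteFold
import HarnessLib

/-!
# Route `UnitScaleTilt`, crux K1 «MinimiserStabilityRegPr» (stmt-QuantumFields-19200), route-R E′ path (α′), row LEMMA-H-CURVED — FILE 3e(i):
# THE COVARIANT HERMITE FOLD — the separable C¹ blend with STRAIGHT-LINE TRANSPORTS along the background `W`:
# `(H^W_μ w)(x) = p(r)·Ad(h⁻(x))⁻¹ w(x⌊μ⌋) + (1 − p(r))·Ad(h⁺(x)) w(x⌊μ⌋ + ℓe_μ)`; interpolation at the centres, and the EXACT covariant second difference in the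
# factor's own direction (interior and knot) — the flat rows of ✓ `Prop7HermiteSecondDiff` §1–§2 transported, no plaquette

Cell `ym3-torus`, D-0154 (3c) twin-width seat `ym-routeR-w1` (gen 5); row "routeR-w1 g5: LEMMA-H-CURVED" (namer ★ym-ust-19200-p1 g14, 2026-08-28 17:33Z), design memo
`DESIGN-FH3-routeRw1g5.md` (19200 evidence) §3.  THEOREMS ONLY (0 `def`, 0 `sorry`); `--supports stmt-QuantumFields-19200`, count-neutral.  YM₃ on T³ is a ladder rung
(R3), not the Clay problem; nothing here claims a stub, the crux, d = 4 or the mass gap.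

WHY.  LEMMA-H-curved ⟸ F-H1 (✓ `Prop7CentreBiharmonicDirichlet.lap_energy_le_of_extension_T3`) + one extension of the centre data with small covariant Laplacian energy.  The
extension is the flat Hermite fold of F-H2 (✓ `Prop7HermiteFold`, `…SecondDiff`, `…Interpolation`) with the two centre-line values of each factor TRANSPORTED to `x` along the
`μ`-line: the lower one `w(x⌊μ⌋)` by `Ad(h⁻(x))⁻¹`, `h⁻(x) = W([x⌊μ⌋ → r steps e_μ])`, the upper one `w(x⌊μ⌋ + ℓe_μ)` by `Ad(h⁺(x))`, `h⁺(x) = W([x → ℓ−r steps e_μ])`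
(`B9Eq39Adjoint` convention: `R(U)f(x+e_μ)` transports backwards along a bond; both are the INLINE letters `holAt W (walk · (List.replicate · (μ, true)))`, no definition).
Folding the `d` directions (`List.foldr` over `List.finRange P.d`, as in F-H2) transports each corner value along the COMB whose last leg is the outermost direction.  THIS
FILE: (§1) at a point all of whose offsets vanish every factor returns the point value (`h⁻ = W([]) = 1`, `p(0) = 1`), so the fold INTERPOLATES the block data at the centres
`embIter k y` (`h = (L^k−1)∕2`, ✓ `Prop7HermiteFold.offset_embIter`, `iterBlockOf_embIter_sub`); (§2) in the factor's own direction the covariant second difference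
`Ad(W(x,μ))Φ(x+e_μ) − 2Φ(x) + Ad(W(x−e_μ,μ))⁻¹Φ(x−e_μ)` (the `μ`-summand of `−Δ_W`, ✓ `Prop7ConjFrameTransport.covDstar_covD_eq_neg_secondDiff` of ★routeR-w4 g9) is EXACTLY
`(p(r+1) − 2p(r) + p(r−1))·(A(x) − B(x))` in the interior (the knot `p(ℓ−1)·(B(c) − 2w(c) + A↓(c))` follows the same way, next file) — F-H3b's identities (✓ `Prop7HermiteLineCovariant`)
instantiated with the offset and centre-line transition rules of ✓ `Prop7HermiteOffsets` and the line recursions.  Curvature enters only in the OTHER directions (memo §1 (A), (B):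
prism and strip terms) — the remaining F-H3 files.

WHAT IS PROVED (ns `…Theorems.Prop7HermiteFoldCovariant`; `SU(N)`, any `P`, finest level, `ℓ ∣ |T|`, profile `p` abstract).
* §1 `stepCov_of_offset_zero`, ★ `foldrCov_of_offsets_zero`, ★★ `foldrCov_embIter` (interpolation: `(H^W(m ∘ B^k(· − h𝟙)))(embIter k y) = m(y)`, any background `W`).
* §2 `iterate_corner`, `iterate_corner_pred`; the evaluations transported to `x`: `stepCov_shift_eq` (interior and knot-approach, `p(ℓ) = 0`), `stepCov_unshift_eq_of_pos`;
  ★★ `covSecondDiff_stepCov_interior` (`1 ≤ r`).  The knot row (`r = 0`: `p(ℓ−1)·(B − 2w(c) + A↓)`, ✓ `secondDiff_line_knot_abstract`) is the next file's first item.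
HONEST SCOPE.  Exact algebra; the values `w` are arbitrary (a factor only reads `w` on the centre lines); no estimate, no plaquette, nothing of Bałaban's beyond the cited letters.

References: T. Bałaban, CMP 98 (1985) 17–51 [Balaban1985Averaging] ((8) p.18, (58) p.27); CMP 99 (1985) 389–434 [Balaban1985BackgroundPropagators] ((3.3), (3.8) pp.390–392);
CMP 95 (1984) 17–40 [Balaban1984PropagatorsI] ((1.18) p.20).
-/

set_option autoImplicit false

noncomputable section

open scoped BigOperators Matrix.Norms.L2Operator

namespace Summit.QuantumFields.YangMills.Theorems.Prop7HermiteFoldCovariant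

open Literature.MathematicalPhysics.QuantumFieldTheory.Balaban1983to89
open T4Continuum BlockAveraging
open Summit.QuantumFields.YangMills.Theorems.Prop7TentInterpolation (shift_eq_update update_update_add)
open Summit.QuantumFields.YangMills.Theorems.Prop7HermiteOffsets (offset_shift offset_unshift corner_shift_of_lt corner_shift_of_eq corner_unshift_of_pos
  corner_unshift_of_zero corner_add_ell offset_add_ell)
open Summit.QuantumFields.YangMills.Theorems.Prop7HermiteFold (offset_embIter iterBlockOf_embIter_sub)
open Summit.QuantumFields.YangMills.Theorems.Prop7HermiteLineCovariant (holAt_walk_replicate_snoc iterate_shift_update secondDiff_line_interior_abstract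
  secondDiff_line_knot_abstract lineUp_recursion lineDown_recursion conj_star_cancel walkEnd_walk_replicate)
open Summit.QuantumFields.YangMills.Theorems.Prop7LineOfTransportedFamily (holAt_walk_replicate_succ)
open Summit.QuantumFields.YangMills.Theorems.Prop7HolRatioPerStep (coe_mul_star_self coe_star_mul_self)
open B5Eq118OneStroke (iterBlockOf)
open B15DeterminingSets (embIter)

variable {P : Params} {n : Type*} [Fintype n] [DecidableEq n] [Nonempty n]

/-! ## §1 Interpolation at the centres -/

section Interp

variable (ℓ : ℕ) (h : ZMod (P.sitesPerDir 0)) (p : ℕ → ℝ) (W : GaugeField P 0 (Matrix.specialUnitaryGroup n ℂ))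

/-- a covariant Hermite factor at a point of zero offset returns the point value (`p(0) = 1`, `W([]) = 1`). [cite: Balaban1985Averaging, (8) p.18] -/
theorem stepCov_of_offset_zero (hp0 : p 0 = 1) (μ : Fin P.d) (w : Site P 0 → Matrix n n ℂ) (x : Site P 0) (hx : (x μ - h).val % ℓ = 0) :
    ((((p ((x μ - h).val % ℓ) : ℝ)) : ℂ) • (star ((holAt W (walk (Function.update x μ (x μ - ((((x μ - h).val % ℓ : ℕ)) : ZMod (P.sitesPerDir 0)))) (List.replicate ((x μ - h).val % ℓ) (μ, true))) : Matrix.specialUnitaryGroup n ℂ) : Matrix n n ℂ) * w (Function.update x μ (x μ - ((((x μ - h).val % ℓ : ℕ)) : ZMod (P.sitesPerDir 0)))) * ((holAt W (walk (Function.update x μ (x μ - ((((x μ - h).val % ℓ : ℕ)) : ZMod (P.sitesPerDir 0)))) (List.replicate ((x μ - h).val % ℓ) (μ, true))) : Matrix.specialUnitaryGroup n ℂ) : Matrix n n ℂ)) + (((1 - p ((x μ - h).val % ℓ) : ℝ)) : ℂ) • (((holAt W (walk x (List.replicate (ℓ - (x μ - h).val % ℓ) (μ, true))) : Matrix.specialUnitaryGroup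 n ℂ) : Matrix n n ℂ) * w (Function.update x μ (x μ - ((((x μ - h).val % ℓ : ℕ)) : ZMod (P.sitesPerDir 0)) + ((ℓ : ℕ) : ZMod (P.sitesPerDir 0)))) * star ((holAt W (walk x (List.replicate (ℓ - (x μ - h).val % ℓ) (μ, true))) : Matrix.specialUnitaryGroup n ℂ) : Matrix n n ℂ))) = w x := by
  rw [hx, hp0, Nat.cast_zero, sub_zero, Function.update_eq_self, List.replicate_zero]
  simp [walk, holAt_nil]

/-- ★ the covariant fold at a point all of whose offsets (in the directions of `l`) vanish returns the point value. [cite: Balaban1985Averaging, (8) p.18] -/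
theorem foldrCov_of_offsets_zero (hp0 : p 0 = 1) (l : List (Fin P.d)) (w : Site P 0 → Matrix n n ℂ) (x : Site P 0) (hx : ∀ μ ∈ l, (x μ - h).val % ℓ = 0) :
    (List.foldr (fun (μ : Fin P.d) (w : Site P 0 → Matrix n n ℂ) (x : Site P 0) => ((((p ((x μ - h).val % ℓ) : ℝ)) : ℂ) • (star ((holAt W (walk (Function.update x μ (x μ - ((((x μ - h).val % ℓ : ℕ)) : ZMod (P.sitesPerDir 0)))) (List.replicate ((x μ - h).val % ℓ) (μ, true))) : Matrix.specialUnitaryGroup n ℂ) : Matrix n n ℂ) * w (Function.update x μ (x μ - ((((x μ - h).val % ℓ : ℕ)) : ZMod (P.sitesPerDir 0)))) * ((holAt W (walk (Function.update x μ (x μ - ((((x μ - h).val % ℓ : ℕ)) : ZMod (P.sitesPerDir 0)))) (List.replicate ((x μ - h).val % ℓ) (μ, true))) : Matrix.specialUnitaryGroup n ℂ) : Matrix n n ℂ)) + (((1 - p ((x μ - h).val % ℓ) : ℝ)) : ℂ) • (((holAt W (walk x (List.replicate (ℓ - (x μ - h).val % ℓ) (μ, true))) : Matrix.specialUnitaryGroup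 n ℂ) : Matrix n n ℂ) * w (Function.update x μ (x μ - ((((x μ - h).val % ℓ : ℕ)) : ZMod (P.sitesPerDir 0)) + ((ℓ : ℕ) : ZMod (P.sitesPerDir 0)))) * star ((holAt W (walk x (List.replicate (ℓ - (x μ - h).val % ℓ) (μ, true))) : Matrix.specialUnitaryGroup n ℂ) : Matrix n n ℂ)))) w l) x = w x := by
  induction l with
  | nil => rfl
  | cons ν l ih =>
    simp only [List.foldr_cons]
    rw [stepCov_of_offset_zero ℓ h p W hp0 ν _ x (hx ν (by simp))]
    exact ih (fun μ hμ => hx μ (by simp [hμ]))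

end Interp

section Centres

variable (p : ℕ → ℝ) (W : GaugeField P 0 (Matrix.specialUnitaryGroup n ℂ))

/-- ★★ **INTERPOLATION AT THE CENTRES**: the covariant Hermite fold (all directions, `ℓ = L^k`, `h = (L^k−1)∕2`, `p(0) = 1`) of the translated block-constant extension
`x ↦ m(B^k(x − h·𝟙))` takes the value `m(y)` at the centre `embIter k y` — whatever the background `W`. [cite: Balaban1984PropagatorsI, (1.18) p.20] -/
theorem foldrCov_embIter {k : ℕ} (hk : k ≤ P.m + P.K) (hp0 : p 0 = 1) (m : Site P k → Matrix n n ℂ) (y : Site P k) :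
    (List.foldr (fun (μ : Fin P.d) (w : Site P 0 → Matrix n n ℂ) (x : Site P 0) => ((((p ((x μ - ((((P.L ^ k - 1) / 2 : ℕ)) : ZMod (P.sitesPerDir 0))).val % P.L ^ k) : ℝ)) : ℂ) • (star ((holAt W (walk (Function.update x μ (x μ - ((((x μ - ((((P.L ^ k - 1) / 2 : ℕ)) : ZMod (P.sitesPerDir 0))).val % P.L ^ k : ℕ)) : ZMod (P.sitesPerDir 0)))) (List.replicate ((x μ - ((((P.L ^ k - 1) / 2 : ℕ)) : ZMod (P.sitesPerDir 0))).val % P.L ^ k) (μ, true))) : Matrix.specialUnitaryGroup n ℂ) : Matrix n n ℂ) * w (Function.update x μ (x μ - ((((x μ - ((((P.L ^ k - 1) / 2 : ℕ)) : ZMod (P.sitesPerDir 0))).val % P.L ^ k : ℕ)) : ZMod (P.sitesPerDir 0)))) * ((holAt W (walk (Function.update x μ (x μ - ((((x μ - ((((P.L ^ k - 1) / 2 : ℕ)) : ZMod (P.sitesPerDir 0))).val % P.L ^ k : ℕ)) : ZMod (P.sitesPerDir 0)))) (List.replicate ((x μ - ((((P.L ^ k - 1) / 2 : ℕ)) : ZMod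 (P.sitesPerDir 0))).val % P.L ^ k) (μ, true))) : Matrix.specialUnitaryGroup n ℂ) : Matrix n n ℂ)) + (((1 - p ((x μ - ((((P.L ^ k - 1) / 2 : ℕ)) : ZMod (P.sitesPerDir 0))).val % P.L ^ k) : ℝ)) : ℂ) • (((holAt W (walk x (List.replicate (P.L ^ k - (x μ - ((((P.L ^ k - 1) / 2 : ℕ)) : ZMod (P.sitesPerDir 0))).val % P.L ^ k) (μ, true))) : Matrix.specialUnitaryGroup n ℂ) : Matrix n n ℂ) * w (Function.update x μ (x μ - ((((x μ - ((((P.L ^ k - 1) / 2 : ℕ)) : ZMod (P.sitesPerDir 0))).val % P.L ^ k : ℕ)) : ZMod (P.sitesPerDir 0)) + ((P.L ^ k : ℕ) : ZMod (P.sitesPerDir 0)))) * star ((holAt W (walk x (List.replicate (P.L ^ k - (x μ - ((((P.L ^ k - 1) / 2 : ℕ)) : ZMod (P.sitesPerDir 0))).val % P.L ^ k) (μ, true))) : Matrix.specialUnitaryGroup n ℂ) : Matrix n n ℂ)))) (fun x : Site P 0 => m (iterBlockOf k (fun ν => x ν - ((((P.L ^ k - 1) / 2 : ℕ)) : ZMod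 (P.sitesPerDir 0))))) (List.finRange P.d)) (embIter k y) = m y := by
  rw [foldrCov_of_offsets_zero (P.L ^ k) _ p W hp0 _ _ _ (fun μ _ => offset_embIter hk y μ)]
  show m (iterBlockOf k _) = m y
  rw [iterBlockOf_embIter_sub hk]

end Centres

/-! ## §2 The factor's own direction: the three evaluations transported to `x`, and the exact covariant second differences -/

section OwnDirection

variable (ℓ : ℕ) (h : ZMod (P.sitesPerDir 0)) (p : ℕ → ℝ) (W : GaugeField P 0 (Matrix.specialUnitaryGroup n ℂ))

omit [Fintype n] [DecidableEq n] [Nonempty n] in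
/-- the `μ`-line through `x`: `(· + e_μ)^[r] (x⌊μ⌋) = x`. [folklore] -/
theorem iterate_corner (x : Site P 0) (μ : Fin P.d) :
    (fun z : Site P 0 => z.shift μ)^[(x μ - h).val % ℓ] (Function.update x μ (x μ - ((((x μ - h).val % ℓ : ℕ)) : ZMod (P.sitesPerDir 0)))) = x := by
  rw [iterate_shift_update, sub_add_cancel, Function.update_eq_self]

omit [Fintype n] [DecidableEq n] [Nonempty n] in
/-- `(· + e_μ)^[r − 1] (x⌊μ⌋) = x − e_μ` for `r ≥ 1`. [folklore] -/
theorem iterate_corner_pred (x : Site P 0) (μ : Fin P.d) (hr : 1 ≤ (x μ - h).val % ℓ) :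
    (fun z : Site P 0 => z.shift μ)^[(x μ - h).val % ℓ - 1] (Function.update x μ (x μ - ((((x μ - h).val % ℓ : ℕ)) : ZMod (P.sitesPerDir 0)))) = x.unshift μ := by
  rw [iterate_shift_update]
  show _ = Function.update x μ (x μ - 1)
  congr 1
  rw [Nat.cast_sub hr, Nat.cast_one]; ring

/-- **FORWARD NEIGHBOUR, transported back**: `Ad(W(x,μ))·(H^W_μ w)(x + e_μ) = p(r+1)·A(x) + (1 − p(r+1))·B(x)` with `A(x) = Ad(h⁻(x))⁻¹w(x⌊μ⌋)`, `B(x) = Ad(h⁺(x))w(x⌊μ⌋ + ℓe_μ)`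
(interior: same cell, line recursions; knot-approach `r + 1 = ℓ`: `x + e_μ` is the upper centre, `p(ℓ) = 0`, `h⁺(x) = W(x,μ)`). [cite: Balaban1985Averaging, (58) p.27] -/
theorem stepCov_shift_eq (hℓN : ℓ ∣ P.sitesPerDir 0) (hℓ : 0 < ℓ) (hp0 : p 0 = 1) (hpℓ : p ℓ = 0) (μ : Fin P.d) (w : Site P 0 → Matrix n n ℂ) (x : Site P 0) :
    ((W ⟨x, μ⟩ : Matrix.specialUnitaryGroup n ℂ) : Matrix n n ℂ) * (((((p (((x.shift μ) μ - h).val % ℓ) : ℝ)) : ℂ) • (star ((holAt W (walk (Function.update (x.shift μ) μ ((x.shift μ) μ - (((((x.shift μ) μ - h).val % ℓ : ℕ)) : ZMod (P.sitesPerDir 0)))) (List.replicate (((x.shift μ) μ - h).val % ℓ) (μ, true))) : Matrix.specialUnitaryGroup n ℂ) : Matrix n n ℂ) * w (Function.update (x.shift μ) μ ((x.shift μ) μ - (((((x.shift μ) μ - h).val % ℓ : ℕ)) : ZMod (P.sitesPerDir 0)))) * ((holAt W (walk (Function.update (x.shift μ) μ ((x.shift μ) μ - (((((x.shift μ) μ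 - h).val % ℓ : ℕ)) : ZMod (P.sitesPerDir 0)))) (List.replicate (((x.shift μ) μ - h).val % ℓ) (μ, true))) : Matrix.specialUnitaryGroup n ℂ) : Matrix n n ℂ)) + (((1 - p (((x.shift μ) μ - h).val % ℓ) : ℝ)) : ℂ) • (((holAt W (walk (x.shift μ) (List.replicate (ℓ - ((x.shift μ) μ - h).val % ℓ) (μ, true))) : Matrix.specialUnitaryGroup n ℂ) : Matrix n n ℂ) * w (Function.update (x.shift μ) μ ((x.shift μ) μ - (((((x.shift μ) μ - h).val % ℓ : ℕ)) : ZMod (P.sitesPerDir 0)) + ((ℓ : ℕ) : ZMod (P.sitesPerDir 0)))) * star ((holAt W (walk (x.shift μ) (List.replicate (ℓ - ((x.shift μ) μ - h).val % ℓ) (μ, true))) : Matrix.specialUnitaryGroup n ℂ) : Matrix n n ℂ)))) * star ((W ⟨x, μ⟩ : Matrix.specialUnitaryGroup n ℂ) : Matrix n n ℂ)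
      = (((p ((x μ - h).val % ℓ + 1) : ℝ)) : ℂ) • (star ((holAt W (walk (Function.update x μ (x μ - ((((x μ - h).val % ℓ : ℕ)) : ZMod (P.sitesPerDir 0)))) (List.replicate ((x μ - h).val % ℓ) (μ, true))) : Matrix.specialUnitaryGroup n ℂ) : Matrix n n ℂ) * w (Function.update x μ (x μ - ((((x μ - h).val % ℓ : ℕ)) : ZMod (P.sitesPerDir 0)))) * ((holAt W (walk (Function.update x μ (x μ - ((((x μ - h).val % ℓ : ℕ)) : ZMod (P.sitesPerDir 0)))) (List.replicate ((x μ - h).val % ℓ) (μ, true))) : Matrix.specialUnitaryGroup n ℂ) : Matrix n n ℂ))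
        + (((1 - p ((x μ - h).val % ℓ + 1) : ℝ)) : ℂ) • (((holAt W (walk x (List.replicate (ℓ - (x μ - h).val % ℓ) (μ, true))) : Matrix.specialUnitaryGroup n ℂ) : Matrix n n ℂ) * w (Function.update x μ (x μ - ((((x μ - h).val % ℓ : ℕ)) : ZMod (P.sitesPerDir 0)) + ((ℓ : ℕ) : ZMod (P.sitesPerDir 0)))) * star ((holAt W (walk x (List.replicate (ℓ - (x μ - h).val % ℓ) (μ, true))) : Matrix.specialUnitaryGroup n ℂ) : Matrix n n ℂ)) := by
  have hlt : (x μ - h).val % ℓ < ℓ := Nat.mod_lt _ hℓ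
  rcases Nat.lt_or_ge ((x μ - h).val % ℓ + 1) ℓ with hr1 | hr1
  · -- interior: same cell
    have hoff : ((x.shift μ) μ - h).val % ℓ = (x μ - h).val % ℓ + 1 := by rw [offset_shift ℓ h hℓN, Nat.mod_eq_of_lt hr1]
    have hc : Function.update (x.shift μ) μ ((x.shift μ) μ - (((((x.shift μ) μ - h).val % ℓ : ℕ)) : ZMod (P.sitesPerDir 0))) = Function.update x μ (x μ - ((((x μ - h).val % ℓ : ℕ)) : ZMod (P.sitesPerDir 0))) := by rw [corner_shift_of_lt ℓ h hℓN x μ hr1]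
    have hcL : Function.update (x.shift μ) μ ((x.shift μ) μ - (((((x.shift μ) μ - h).val % ℓ : ℕ)) : ZMod (P.sitesPerDir 0)) + ((ℓ : ℕ) : ZMod (P.sitesPerDir 0))) = Function.update x μ (x μ - ((((x μ - h).val % ℓ : ℕ)) : ZMod (P.sitesPerDir 0)) + ((ℓ : ℕ) : ZMod (P.sitesPerDir 0))) := by
      rw [hoff, shift_eq_update]
      funext κ; by_cases hκ : κ = μ
      · subst hκ; simp only [Function.update_self]; push_cast; ring
      · simp only [Function.update_of_ne hκ]
    rw [hc, hcL, hoff]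
    have hA := lineDown_recursion W (Function.update x μ (x μ - ((((x μ - h).val % ℓ : ℕ)) : ZMod (P.sitesPerDir 0)))) μ ((x μ - h).val % ℓ) (w (Function.update x μ (x μ - ((((x μ - h).val % ℓ : ℕ)) : ZMod (P.sitesPerDir 0)))))
    rw [iterate_corner ℓ h x μ] at hA
    have hB := lineUp_recursion W x μ (ℓ - ((x μ - h).val % ℓ + 1)) (w (Function.update x μ (x μ - ((((x μ - h).val % ℓ : ℕ)) : ZMod (P.sitesPerDir 0)) + ((ℓ : ℕ) : ZMod (P.sitesPerDir 0)))))
    rw [show ℓ - ((x μ - h).val % ℓ + 1) + 1 = ℓ - (x μ - h).val % ℓ by omega] at hB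
    rw [Matrix.mul_add, Matrix.add_mul, Matrix.mul_smul, Matrix.smul_mul, Matrix.mul_smul, Matrix.smul_mul, hA, hB]
  · -- knot-approach: `r + 1 = ℓ`
    have hr' : (x μ - h).val % ℓ + 1 = ℓ := le_antisymm hlt hr1
    have hoff : ((x.shift μ) μ - h).val % ℓ = 0 := by rw [offset_shift ℓ h hℓN, hr', Nat.mod_self]
    have hℓr : ((ℓ : ℕ) : ZMod (P.sitesPerDir 0)) = ((((x μ - h).val % ℓ : ℕ)) : ZMod (P.sitesPerDir 0)) + 1 := by
      have e := congrArg (fun t : ℕ => (t : ZMod (P.sitesPerDir 0))) hr'.symm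
      simpa only [Nat.cast_add, Nat.cast_one] using e
    have hxs : x.shift μ = Function.update x μ (x μ - ((((x μ - h).val % ℓ : ℕ)) : ZMod (P.sitesPerDir 0)) + ((ℓ : ℕ) : ZMod (P.sitesPerDir 0))) := by
      rw [shift_eq_update]
      funext κ; by_cases hκ : κ = μ
      · subst hκ; simp only [Function.update_self]; rw [hℓr]; ring
      · simp only [Function.update_of_ne hκ]
    have hstep : ((((p (((x.shift μ) μ - h).val % ℓ) : ℝ)) : ℂ) • (star ((holAt W (walk (Function.update (x.shift μ) μ ((x.shift μ) μ - (((((x.shift μ) μ - h).val % ℓ : ℕ)) : ZMod (P.sitesPerDir 0)))) (List.replicate (((x.shift μ) μ - h).val % ℓ) (μ, true))) : Matrix.specialUnitaryGroup n ℂ) : Matrix n n ℂ) * w (Function.update (x.shift μ) μ ((x.shift μ) μ - (((((x.shift μ) μ - h).val % ℓ : ℕ)) : ZMod (P.sitesPerDir 0)))) * ((holAt W (walk (Function.update (x.shift μ) μ ((x.shift μ) μ - (((((x.shift μ) μ - h).val % ℓ : ℕ)) : ZMod (P.sitesPerDir 0)))) (List.replicate (((x.shift μ) μ - h).val % ℓ)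 (μ, true))) : Matrix.specialUnitaryGroup n ℂ) : Matrix n n ℂ)) + (((1 - p (((x.shift μ) μ - h).val % ℓ) : ℝ)) : ℂ) • (((holAt W (walk (x.shift μ) (List.replicate (ℓ - ((x.shift μ) μ - h).val % ℓ) (μ, true))) : Matrix.specialUnitaryGroup n ℂ) : Matrix n n ℂ) * w (Function.update (x.shift μ) μ ((x.shift μ) μ - (((((x.shift μ) μ - h).val % ℓ : ℕ)) : ZMod (P.sitesPerDir 0)) + ((ℓ : ℕ) : ZMod (P.sitesPerDir 0)))) * star ((holAt W (walk (x.shift μ) (List.replicate (ℓ - ((x.shift μ) μ - h).val % ℓ) (μ, true))) : Matrix.specialUnitaryGroup n ℂ) : Matrix n n ℂ))) = w (x.shift μ) := stepCov_of_offset_zero ℓ h p W hp0 μ w (x.shift μ) hoff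
    rw [hstep, hr', hpℓ]
    have hH : holAt W (walk x (List.replicate (ℓ - (x μ - h).val % ℓ) (μ, true))) = W ⟨x, μ⟩ := by
      rw [show ℓ - (x μ - h).val % ℓ = 0 + 1 by omega, holAt_walk_replicate_succ, List.replicate_zero]
      simp [walk, holAt_nil]
    rw [hH, hxs]
    push_cast
    simp only [zero_smul, zero_add, sub_zero, one_smul]

/-- **BACKWARD NEIGHBOUR, INTERIOR** (`r ≥ 1`), transported forward: `Ad(W(x−e_μ,μ))⁻¹·(H^W_μ w)(x − e_μ) = p(r−1)·A(x) + (1 − p(r−1))·B(x)`.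
[cite: Balaban1985Averaging, (58) p.27] -/
theorem stepCov_unshift_eq_of_pos (hℓN : ℓ ∣ P.sitesPerDir 0) (hℓ : 0 < ℓ) (μ : Fin P.d) (w : Site P 0 → Matrix n n ℂ) (x : Site P 0) (hr : 1 ≤ (x μ - h).val % ℓ) :
    star ((W ⟨x.unshift μ, μ⟩ : Matrix.specialUnitaryGroup n ℂ) : Matrix n n ℂ) * (((((p (((x.unshift μ) μ - h).val % ℓ) : ℝ)) : ℂ) • (star ((holAt W (walk (Function.update (x.unshift μ) μ ((x.unshift μ) μ - (((((x.unshift μ) μ - h).val % ℓ : ℕ)) : ZMod (P.sitesPerDir 0)))) (List.replicate (((x.unshift μ) μ - h).val % ℓ) (μ, true))) : Matrix.specialUnitaryGroup n ℂ) : Matrix n n ℂ) * w (Function.update (x.unshift μ) μ ((x.unshift μ) μ - (((((x.unshift μ) μ - h).val % ℓ : ℕ)) : ZMod (P.sitesPerDir 0)))) * ((holAt W (walk (Function.update (x.unshift μ) μ ((x.unshift μ) μ - (((((x.unshift μ) μ - h).val % ℓ : ℕ)) : ZMod (P.sitesPerDir 0)))) (List.replicate (((x.unshift μ) μ - h).val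 % ℓ) (μ, true))) : Matrix.specialUnitaryGroup n ℂ) : Matrix n n ℂ)) + (((1 - p (((x.unshift μ) μ - h).val % ℓ) : ℝ)) : ℂ) • (((holAt W (walk (x.unshift μ) (List.replicate (ℓ - ((x.unshift μ) μ - h).val % ℓ) (μ, true))) : Matrix.specialUnitaryGroup n ℂ) : Matrix n n ℂ) * w (Function.update (x.unshift μ) μ ((x.unshift μ) μ - (((((x.unshift μ) μ - h).val % ℓ : ℕ)) : ZMod (P.sitesPerDir 0)) + ((ℓ : ℕ) : ZMod (P.sitesPerDir 0)))) * star ((holAt W (walk (x.unshift μ) (List.replicate (ℓ - ((x.unshift μ) μ - h).val % ℓ) (μ, true))) : Matrix.specialUnitaryGroup n ℂ) : Matrix n n ℂ)))) * ((W ⟨x.unshift μ, μ⟩ : Matrix.specialUnitaryGroup n ℂ) : Matrix n n ℂ)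
      = (((p ((x μ - h).val % ℓ - 1) : ℝ)) : ℂ) • (star ((holAt W (walk (Function.update x μ (x μ - ((((x μ - h).val % ℓ : ℕ)) : ZMod (P.sitesPerDir 0)))) (List.replicate ((x μ - h).val % ℓ) (μ, true))) : Matrix.specialUnitaryGroup n ℂ) : Matrix n n ℂ) * w (Function.update x μ (x μ - ((((x μ - h).val % ℓ : ℕ)) : ZMod (P.sitesPerDir 0)))) * ((holAt W (walk (Function.update x μ (x μ - ((((x μ - h).val % ℓ : ℕ)) : ZMod (P.sitesPerDir 0)))) (List.replicate ((x μ - h).val % ℓ) (μ, true))) : Matrix.specialUnitaryGroup n ℂ) : Matrix n n ℂ))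
        + (((1 - p ((x μ - h).val % ℓ - 1) : ℝ)) : ℂ) • (((holAt W (walk x (List.replicate (ℓ - (x μ - h).val % ℓ) (μ, true))) : Matrix.specialUnitaryGroup n ℂ) : Matrix n n ℂ) * w (Function.update x μ (x μ - ((((x μ - h).val % ℓ : ℕ)) : ZMod (P.sitesPerDir 0)) + ((ℓ : ℕ) : ZMod (P.sitesPerDir 0)))) * star ((holAt W (walk x (List.replicate (ℓ - (x μ - h).val % ℓ) (μ, true))) : Matrix.specialUnitaryGroup n ℂ) : Matrix n n ℂ)) := by
  have hlt : (x μ - h).val % ℓ < ℓ := Nat.mod_lt _ hℓ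
  have hsum : (x μ - h).val % ℓ + (ℓ - 1) = ((x μ - h).val % ℓ - 1) + ℓ := by omega
  have hoff : ((x.unshift μ) μ - h).val % ℓ = (x μ - h).val % ℓ - 1 := by
    rw [offset_unshift ℓ h hℓN, hsum, Nat.add_mod_right, Nat.mod_eq_of_lt (by omega)]
  have hc : Function.update (x.unshift μ) μ ((x.unshift μ) μ - (((((x.unshift μ) μ - h).val % ℓ : ℕ)) : ZMod (P.sitesPerDir 0))) = Function.update x μ (x μ - ((((x μ - h).val % ℓ : ℕ)) : ZMod (P.sitesPerDir 0))) := by rw [corner_unshift_of_pos ℓ h hℓN hℓ x μ hr]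
  have hcL : Function.update (x.unshift μ) μ ((x.unshift μ) μ - (((((x.unshift μ) μ - h).val % ℓ : ℕ)) : ZMod (P.sitesPerDir 0)) + ((ℓ : ℕ) : ZMod (P.sitesPerDir 0))) = Function.update x μ (x μ - ((((x μ - h).val % ℓ : ℕ)) : ZMod (P.sitesPerDir 0)) + ((ℓ : ℕ) : ZMod (P.sitesPerDir 0))) := by
    rw [hoff]
    show Function.update (Function.update x μ (x μ - 1)) μ (Function.update x μ (x μ - 1) μ - ((((x μ - h).val % ℓ - 1 : ℕ)) : ZMod (P.sitesPerDir 0)) + ((ℓ : ℕ) : ZMod (P.sitesPerDir 0))) = _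
    funext κ; by_cases hκ : κ = μ
    · subst hκ; simp only [Function.update_self]; rw [Nat.cast_sub hr, Nat.cast_one]; ring
    · simp only [Function.update_of_ne hκ]
  rw [hc, hcL, hoff]
  -- lower value: `h⁻ at offset r = (h⁻ at offset r − 1)·W(x − e_μ, μ)` (snoc), a pure reassociation
  have e := holAt_walk_replicate_snoc W (Function.update x μ (x μ - ((((x μ - h).val % ℓ : ℕ)) : ZMod (P.sitesPerDir 0)))) μ ((x μ - h).val % ℓ - 1)
  rw [iterate_corner_pred ℓ h x μ hr, show (x μ - h).val % ℓ - 1 + 1 = (x μ - h).val % ℓ by omega] at e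
  have hA : star ((W ⟨x.unshift μ, μ⟩ : Matrix.specialUnitaryGroup n ℂ) : Matrix n n ℂ) * (star ((holAt W (walk (Function.update x μ (x μ - ((((x μ - h).val % ℓ : ℕ)) : ZMod (P.sitesPerDir 0)))) (List.replicate ((x μ - h).val % ℓ - 1) (μ, true))) : Matrix.specialUnitaryGroup n ℂ) : Matrix n n ℂ) * w (Function.update x μ (x μ - ((((x μ - h).val % ℓ : ℕ)) : ZMod (P.sitesPerDir 0)))) * ((holAt W (walk (Function.update x μ (x μ - ((((x μ - h).val % ℓ : ℕ)) : ZMod (P.sitesPerDir 0)))) (List.replicate ((x μ - h).val % ℓ - 1) (μ, true))) : Matrix.specialUnitaryGroup n ℂ) : Matrix n n ℂ)) * ((W ⟨x.unshift μ, μ⟩ : Matrix.specialUnitaryGroup n ℂ) : Matrix n n ℂ)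
      = star ((holAt W (walk (Function.update x μ (x μ - ((((x μ - h).val % ℓ : ℕ)) : ZMod (P.sitesPerDir 0)))) (List.replicate ((x μ - h).val % ℓ) (μ, true))) : Matrix.specialUnitaryGroup n ℂ) : Matrix n n ℂ) * w (Function.update x μ (x μ - ((((x μ - h).val % ℓ : ℕ)) : ZMod (P.sitesPerDir 0)))) * ((holAt W (walk (Function.update x μ (x μ - ((((x μ - h).val % ℓ : ℕ)) : ZMod (P.sitesPerDir 0)))) (List.replicate ((x μ - h).val % ℓ) (μ, true))) : Matrix.specialUnitaryGroup n ℂ) : Matrix n n ℂ) := by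
    rw [e]; push_cast; rw [star_mul]; simp only [Matrix.mul_assoc]
  -- upper value: `h⁺(x − e_μ) = W(x−e_μ,μ)·h⁺(x)` (succ), then `W₋*·W₋ = 1` twice
  have e2 := holAt_walk_replicate_succ W (x.unshift μ) μ (ℓ - (x μ - h).val % ℓ)
  rw [show ℓ - (x μ - h).val % ℓ + 1 = ℓ - ((x μ - h).val % ℓ - 1) by omega] at e2
  have hsu : (x.unshift μ).shift μ = x := by
    funext κ; by_cases hκ : κ = μ
    · subst hκ; simp [Site.shift, Site.unshift]
    · simp [Site.shift, Site.unshift, hκ]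
  rw [hsu] at e2
  have hB : star ((W ⟨x.unshift μ, μ⟩ : Matrix.specialUnitaryGroup n ℂ) : Matrix n n ℂ)
      * (((holAt W (walk (x.unshift μ) (List.replicate (ℓ - ((x μ - h).val % ℓ - 1)) (μ, true))) : Matrix.specialUnitaryGroup n ℂ) : Matrix n n ℂ) * w (Function.update x μ (x μ - ((((x μ - h).val % ℓ : ℕ)) : ZMod (P.sitesPerDir 0)) + ((ℓ : ℕ) : ZMod (P.sitesPerDir 0))))
          * star ((holAt W (walk (x.unshift μ) (List.replicate (ℓ - ((x μ - h).val % ℓ - 1)) (μ, true))) : Matrix.specialUnitaryGroup n ℂ) : Matrix n n ℂ))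
      * ((W ⟨x.unshift μ, μ⟩ : Matrix.specialUnitaryGroup n ℂ) : Matrix n n ℂ) = ((holAt W (walk x (List.replicate (ℓ - (x μ - h).val % ℓ) (μ, true))) : Matrix.specialUnitaryGroup n ℂ) : Matrix n n ℂ) * w (Function.update x μ (x μ - ((((x μ - h).val % ℓ : ℕ)) : ZMod (P.sitesPerDir 0)) + ((ℓ : ℕ) : ZMod (P.sitesPerDir 0)))) * star ((holAt W (walk x (List.replicate (ℓ - (x μ - h).val % ℓ) (μ, true))) : Matrix.specialUnitaryGroup n ℂ) : Matrix n n ℂ) := by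
    rw [e2]; push_cast; rw [star_mul]
    have hre : star ((W ⟨x.unshift μ, μ⟩ : Matrix.specialUnitaryGroup n ℂ) : Matrix n n ℂ) * (((W ⟨x.unshift μ, μ⟩ : Matrix.specialUnitaryGroup n ℂ) : Matrix n n ℂ) * ((holAt W (walk x (List.replicate (ℓ - (x μ - h).val % ℓ) (μ, true))) : Matrix.specialUnitaryGroup n ℂ) : Matrix n n ℂ) * w (Function.update x μ (x μ - ((((x μ - h).val % ℓ : ℕ)) : ZMod (P.sitesPerDir 0)) + ((ℓ : ℕ) : ZMod (P.sitesPerDir 0)))) * (star ((holAt W (walk x (List.replicate (ℓ - (x μ - h).val % ℓ) (μ, true))) : Matrix.specialUnitaryGroup n ℂ) : Matrix n n ℂ) * star ((W ⟨x.unshift μ, μ⟩ : Matrix.specialUnitaryGroup n ℂ) : Matrix n n ℂ))) * ((W ⟨x.unshift μ, μ⟩ : Matrix.specialUnitaryGroup n ℂ) : Matrix n n ℂ)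
        = star ((W ⟨x.unshift μ, μ⟩ : Matrix.specialUnitaryGroup n ℂ) : Matrix n n ℂ) * (((W ⟨x.unshift μ, μ⟩ : Matrix.specialUnitaryGroup n ℂ) : Matrix n n ℂ) * (((holAt W (walk x (List.replicate (ℓ - (x μ - h).val % ℓ) (μ, true))) : Matrix.specialUnitaryGroup n ℂ) : Matrix n n ℂ) * w (Function.update x μ (x μ - ((((x μ - h).val % ℓ : ℕ)) : ZMod (P.sitesPerDir 0)) + ((ℓ : ℕ) : ZMod (P.sitesPerDir 0)))) * star ((holAt W (walk x (List.replicate (ℓ - (x μ - h).val % ℓ) (μ, true))) : Matrix.specialUnitaryGroup n ℂ) : Matrix n n ℂ)) * star ((W ⟨x.unshift μ, μ⟩ : Matrix.specialUnitaryGroup n ℂ) : Matrix n n ℂ)) * ((W ⟨x.unshift μ, μ⟩ : Matrix.specialUnitaryGroup n ℂ) : Matrix n n ℂ) := by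
      simp only [Matrix.mul_assoc]
    rw [hre]
    exact conj_star_cancel (W ⟨x.unshift μ, μ⟩) _
  rw [Matrix.mul_add, Matrix.add_mul, Matrix.mul_smul, Matrix.smul_mul, Matrix.mul_smul, Matrix.smul_mul, hA, hB]

/-- ★★ **THE COVARIANT SECOND DIFFERENCE IN THE FACTOR'S OWN DIRECTION, INTERIOR** (`r ≥ 1`; `p(0) = 1`, `p(ℓ) = 0` cover the knot-approach `r + 1 = ℓ`):
`Ad(W(x,μ))·(H^W_μw)(x+e_μ) − 2(H^W_μw)(x) + Ad(W(x−e_μ,μ))⁻¹·(H^W_μw)(x−e_μ) = (p(r+1) − 2p(r) + p(r−1))·(A(x) − B(x))` — NO plaquette: the flat row of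
✓ `Prop7HermiteSecondDiff` transported. [cite: Balaban1985BackgroundPropagators, (3.3) p.390; Balaban1985Averaging, (58) p.27] -/
theorem covSecondDiff_stepCov_interior (hℓN : ℓ ∣ P.sitesPerDir 0) (hℓ : 0 < ℓ) (hp0 : p 0 = 1) (hpℓ : p ℓ = 0) (μ : Fin P.d) (w : Site P 0 → Matrix n n ℂ)
    (x : Site P 0) (hr : 1 ≤ (x μ - h).val % ℓ) :
    ((W ⟨x, μ⟩ : Matrix.specialUnitaryGroup n ℂ) : Matrix n n ℂ) * (((((p (((x.shift μ) μ - h).val % ℓ) : ℝ)) : ℂ) • (star ((holAt W (walk (Function.update (x.shift μ) μ ((x.shift μ) μ - (((((x.shift μ) μ - h).val % ℓ : ℕ)) : ZMod (P.sitesPerDir 0)))) (List.replicate (((x.shift μ) μ - h).val % ℓ) (μ, true))) : Matrix.specialUnitaryGroup n ℂ) : Matrix n n ℂ) * w (Function.update (x.shift μ) μ ((x.shift μ) μ - (((((x.shift μ) μ - h).val % ℓ : ℕ)) : ZMod (P.sitesPerDir 0)))) * ((holAt W (walk (Function.update (x.shift μ) μ ((x.shift μ) μ - (((((x.shift μ)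 μ - h).val % ℓ : ℕ)) : ZMod (P.sitesPerDir 0)))) (List.replicate (((x.shift μ) μ - h).val % ℓ) (μ, true))) : Matrix.specialUnitaryGroup n ℂ) : Matrix n n ℂ)) + (((1 - p (((x.shift μ) μ - h).val % ℓ) : ℝ)) : ℂ) • (((holAt W (walk (x.shift μ) (List.replicate (ℓ - ((x.shift μ) μ - h).val % ℓ) (μ, true))) : Matrix.specialUnitaryGroup n ℂ) : Matrix n n ℂ) * w (Function.update (x.shift μ) μ ((x.shift μ) μ - (((((x.shift μ) μ - h).val % ℓ : ℕ)) : ZMod (P.sitesPerDir 0)) + ((ℓ : ℕ) : ZMod (P.sitesPerDir 0)))) * star ((holAt W (walk (x.shift μ) (List.replicate (ℓ - ((x.shift μ) μ - h).val % ℓ) (μ, true))) : Matrix.specialUnitaryGroup n ℂ) : Matrix n n ℂ)))) * star ((W ⟨x, μ⟩ : Matrix.specialUnitaryGroup n ℂ) : Matrix n n ℂ)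
      - (2 : ℂ) • (((((p ((x μ - h).val % ℓ) : ℝ)) : ℂ) • (star ((holAt W (walk (Function.update x μ (x μ - ((((x μ - h).val % ℓ : ℕ)) : ZMod (P.sitesPerDir 0)))) (List.replicate ((x μ - h).val % ℓ) (μ, true))) : Matrix.specialUnitaryGroup n ℂ) : Matrix n n ℂ) * w (Function.update x μ (x μ - ((((x μ - h).val % ℓ : ℕ)) : ZMod (P.sitesPerDir 0)))) * ((holAt W (walk (Function.update x μ (x μ - ((((x μ - h).val % ℓ : ℕ)) : ZMod (P.sitesPerDir 0)))) (List.replicate ((x μ - h).val % ℓ) (μ, true))) : Matrix.specialUnitaryGroup n ℂ) : Matrix n n ℂ)) + (((1 - p ((x μ - h).val % ℓ) : ℝ)) : ℂ) • (((holAt W (walk x (List.replicate (ℓ - (x μ - h).val % ℓ) (μ, true))) : Matrix.specialUnitaryGroup n ℂ) : Matrix n n ℂ) * w (Function.update x μ (x μ - ((((x μ - h).val % ℓ : ℕ)) : ZMod (P.sitesPerDir 0)) + ((ℓ : ℕ) : ZMod (P.sitesPerDir 0)))) * star ((holAt W (walk x (List.replicate (ℓ - (x μ - h).val % ℓ) (μ,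 true))) : Matrix.specialUnitaryGroup n ℂ) : Matrix n n ℂ))))
      + star ((W ⟨x.unshift μ, μ⟩ : Matrix.specialUnitaryGroup n ℂ) : Matrix n n ℂ) * (((((p (((x.unshift μ) μ - h).val % ℓ) : ℝ)) : ℂ) • (star ((holAt W (walk (Function.update (x.unshift μ) μ ((x.unshift μ) μ - (((((x.unshift μ) μ - h).val % ℓ : ℕ)) : ZMod (P.sitesPerDir 0)))) (List.replicate (((x.unshift μ) μ - h).val % ℓ) (μ, true))) : Matrix.specialUnitaryGroup n ℂ) : Matrix n n ℂ) * w (Function.update (x.unshift μ) μ ((x.unshift μ) μ - (((((x.unshift μ) μ - h).val % ℓ : ℕ)) : ZMod (P.sitesPerDir 0)))) * ((holAt W (walk (Function.update (x.unshift μ) μ ((x.unshift μ) μ - (((((x.unshift μ) μ - h).val % ℓ : ℕ)) : ZMod (P.sitesPerDir 0)))) (List.replicate (((x.unshift μ) μ - h).val % ℓ) (μ, true))) : Matrix.specialUnitaryGroup n ℂ) : Matrix n n ℂ)) + (((1 - p (((x.unshift μ) μ - h).val % ℓ) : ℝ)) : ℂ) • (((holAt W (walk (x.unshift μ) (List.replicate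 (ℓ - ((x.unshift μ) μ - h).val % ℓ) (μ, true))) : Matrix.specialUnitaryGroup n ℂ) : Matrix n n ℂ) * w (Function.update (x.unshift μ) μ ((x.unshift μ) μ - (((((x.unshift μ) μ - h).val % ℓ : ℕ)) : ZMod (P.sitesPerDir 0)) + ((ℓ : ℕ) : ZMod (P.sitesPerDir 0)))) * star ((holAt W (walk (x.unshift μ) (List.replicate (ℓ - ((x.unshift μ) μ - h).val % ℓ) (μ, true))) : Matrix.specialUnitaryGroup n ℂ) : Matrix n n ℂ)))) * ((W ⟨x.unshift μ, μ⟩ : Matrix.specialUnitaryGroup n ℂ) : Matrix n n ℂ)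
      = (((p ((x μ - h).val % ℓ + 1) - 2 * p ((x μ - h).val % ℓ) + p ((x μ - h).val % ℓ - 1) : ℝ)) : ℂ)
          • (star ((holAt W (walk (Function.update x μ (x μ - ((((x μ - h).val % ℓ : ℕ)) : ZMod (P.sitesPerDir 0)))) (List.replicate ((x μ - h).val % ℓ) (μ, true))) : Matrix.specialUnitaryGroup n ℂ) : Matrix n n ℂ) * w (Function.update x μ (x μ - ((((x μ - h).val % ℓ : ℕ)) : ZMod (P.sitesPerDir 0)))) * ((holAt W (walk (Function.update x μ (x μ - ((((x μ - h).val % ℓ : ℕ)) : ZMod (P.sitesPerDir 0)))) (List.replicate ((x μ - h).val % ℓ) (μ, true))) : Matrix.specialUnitaryGroup n ℂ) : Matrix n n ℂ) - ((holAt W (walk x (List.replicate (ℓ - (x μ - h).val % ℓ) (μ, true))) : Matrix.specialUnitaryGroup n ℂ) : Matrix n n ℂ) * w (Function.update x μ (x μ - ((((x μ - h).val % ℓ : ℕ)) : ZMod (P.sitesPerDir 0)) + ((ℓ : ℕ) : ZMod (P.sitesPerDir 0)))) * star ((holAt W (walk x (List.replicate (ℓ - (x μ - h).val % ℓ) (μ,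 true))) : Matrix.specialUnitaryGroup n ℂ) : Matrix n n ℂ)) := by
  rw [stepCov_shift_eq ℓ h p W hℓN hℓ hp0 hpℓ μ w x, stepCov_unshift_eq_of_pos ℓ h p W hℓN hℓ μ w x hr]
  push_cast
  simp only [sub_smul, smul_sub, add_smul, smul_add, one_smul, mul_smul, two_smul]
  abel

end OwnDirection

end Summit.QuantumFields.YangMills.Theorems.Prop7HermiteFoldCovariant

end
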